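import Literature.NumberTheory.Automorphic.RamifiedPrimeIdeal
import HarnessLib

/-!
# Brandt matrices at a ramified prime: `B(p)` is an involutive permutation matrix
# (Vignéras, LNM 800, Ch. III §5 ex. 5.8: `c(p) = 1` and `P(p^a) P(p^b) = P(p^{a+b})` for `p ∣ D`)

Topic `NumberTheory/Automorphic`; theorems only (no definition, no named fact, no instance).
Let `O` be a `ℤ`-order of a quaternion algebra `B` over `ℚ`, maximal at a prime `p` with
`ℚ_p ⊗ B` a division algebra (e.g. the Eichler order of an Eichler package, `p ∣ N⁻`), and
`P = normPrimeIdeal O p` its prime above `p` (`RamifiedPrimeIdeal*.lean`: two-sided, `[O : P] = p²`,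
`P_(p) = u O_(p)`, `(P P)_(p) = p O_(p)`, `P_(p)` the only right ideal of index `p²`). For an
invertible right `O`-ideal `I`:

* `isInvertibleRightIdeal_mul_normPrimeIdeal`, `relIndex_mul_normPrimeIdeal` — **`I P` is an
  invertible right `O`-ideal inside `I` of index `p²`** (locally principal: `β u` at `p`, the
  generator of `I` elsewhere);
* `eq_mul_normPrimeIdeal_of_relIndex_eq_sq` — **it is the only one**: an invertible right
  `O`-ideal `M ⊆ I` with `[I : M] = p²` equals `I P` (it contains `p I`, so agrees with `I` away
  from `p`, and `β⁻¹ M_(p)` is a right ideal of `O_(p)` of index `p²`, i.e. `P_(p)`);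
* `mul_normPrimeIdeal_mul_normPrimeIdeal` — `I P P = p I`;
* hence for the Brandt data `BrandtData.ofOrder O` (`BrandtModule.lean`):
  `subidealCount_ramified` — `B(p)_{[I] j} = [j = [I P]]`; **`∑ j B(p)_{ij} = 1`**
  (`BrandtData.ofOrder_T_ramified_sum`: Vignéras III §5 ex. 5.8 (b), `c(p) = 1 si p ∣ D`) and
  **`B(p) B(p) = 1`** (`BrandtData.ofOrder_T_ramified_mul_self`: ex. 5.8 (c),
  `P(p) P(p) = P(p²)`, and `P(p²) = L(p) = 1` over `ℚ`) — the Atkin–Lehner involution `W_p` on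
  the Brandt module at `p ∣ disc B`;
* `EichlerPackage.T_mul_T_self_of_dvd` — the same for every Eichler package at `p ∣ N⁻`.

## References

* M.-F. Vignéras, *Arithmétique des algèbres de quaternions*, LNM 800 (1980), Ch. II §1
  Cor. 1.7; Ch. III §5 exercice 5.8 (b), (c), p. 87 [VignerasLNM800].
* A. Pizer, *An algorithm for computing modular forms on `Γ₀(N)`*, J. Algebra 64 (1980), §2
  [Pizer1980].
-/

noncomputable section

open scoped Pointwise

universe u

namespace Literature.NumberTheory.Automorphic

variable {B : Type u} [Ring B] [Algebra ℚ B] [IsQuaternionAlgebra ℚ B]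
variable {O : Submodule ℤ B} {p : ℕ} [hp : Fact p.Prime]

/-! ### The ideal `I P` -/

section IdealIP

omit [IsQuaternionAlgebra ℚ B] hp in
/-- `I P ⊆ I` for a right `O`-module `I`. [folklore] -/
theorem mul_normPrimeIdeal_le [IsQuaternionAlgebra ℚ B] {I : Submodule ℤ B} (hI : IsInvertibleRightIdeal O I) :
    I * normPrimeIdeal O p ≤ I :=
  Submodule.mul_le.mpr fun _ hx _ hy => hI.mul_mem hx (normPrimeIdeal_le O p hy)

omit hp in
/-- `p I ⊆ I P` (`p · 1 ∈ P`). [folklore] -/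
theorem smul_le_mul_normPrimeIdeal (hO : IsZOrder O) (I : Submodule ℤ B) :
    (p : ℤ) • I ≤ I * normPrimeIdeal O p := by
  intro z hz
  obtain ⟨x, hx, rfl⟩ := (Submodule.mem_smul_pointwise_iff_exists z _ I).mp hz
  have h1 : (p : ℤ) • (1 : B) ∈ normPrimeIdeal O p :=
    smul_le_normPrimeIdeal hO (Submodule.smul_mem_pointwise_smul _ _ O hO.one_mem)
  have : (p : ℤ) • x = x * ((p : ℤ) • (1 : B)) := by rw [mul_smul_comm, mul_one]
  rw [this]
  exact Submodule.mul_mem_mul hx h1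

omit hp in
/-- `O P = P` (the prime ideal is a left `O`-module containing `1 · P`). [folklore] -/
theorem order_mul_normPrimeIdeal (hO : IsZOrder O) : O * normPrimeIdeal O p = normPrimeIdeal O p := by
  refine le_antisymm (Submodule.mul_le.mpr fun a ha x hx => mul_mem_normPrimeIdeal_left hO ha hx)
    fun x hx => ?_
  rw [← one_mul x]
  exact Submodule.mul_mem_mul hO.one_mem hx

variable (hdivp : ∀ X : ScalarExtension ℚ ℚ_[p] B, X ≠ 0 → IsUnit X)
variable (hOp : ∀ x : B, x ∈ localAt p O ↔
  ¬ p ∣ (reducedNorm ℚ B x).den ∧ ¬ p ∣ (reducedTrace ℚ B x).den)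
include hdivp hOp

omit hdivp hOp in
/-- Away from `p`, `I P` and `I` agree: `(I P)_(q) = I_(q)` for primes `q ≠ p`. [folklore] -/
theorem localAt_mul_normPrimeIdeal_of_ne (hO : IsZOrder O) {I : Submodule ℤ B}
    (hI : IsInvertibleRightIdeal O I) {q : ℕ} (hq : q.Prime) (hqp : q ≠ p) :
    localAt q (I * normPrimeIdeal O p) = localAt q I :=
  (localAt_eq_of_smul_le (mul_normPrimeIdeal_le hI) hp.out.ne_zero
    ((Nat.coprime_primes hp.out hq).mpr (Ne.symm hqp)) fun x hx =>
      smul_le_mul_normPrimeIdeal hO I (Submodule.smul_mem_pointwise_smul x _ I hx)).symm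

/-- At `p`: if `I_(p) = β O_(p)` and `u` is a uniformiser then `(I P)_(p) = (β u) O_(p)`. [cite: VignerasLNM800, Ch. II §1 Cor. 1.7] -/
theorem localAt_mul_normPrimeIdeal_self (hO : IsZOrder O) {I : Submodule ℤ B} {β : Bˣ}
    (hβ : localAt p I = β • localAt p O) {u : Bˣ} (hu : (u : B) ∈ normPrimeIdeal O p)
    (hup : (u : B) ∉ (p : ℤ) • O) :
    localAt p (I * normPrimeIdeal O p) = (β * u) • localAt p O := by
  rw [← localAt_mul_localAt_eq, hβ, localAt_normPrimeIdeal_eq_units_smul hdivp hOp hO hu hup,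
    smul_mul_assoc, mul_smul]
  congr 1
  -- `O_(p) · u O_(p) = u O_(p)`
  refine le_antisymm (Submodule.mul_le.mpr fun a ha x hx => ?_) fun x hx => ?_
  · rw [← localAt_normPrimeIdeal_eq_units_smul hdivp hOp hO hu hup] at hx ⊢
    have h : localAt p O * localAt p (normPrimeIdeal O p) ≤ localAt p (normPrimeIdeal O p) := by
      rw [localAt_mul_localAt_eq, order_mul_normPrimeIdeal hO]
    exact h (Submodule.mul_mem_mul ha hx)
  · rw [← one_mul x]
    exact Submodule.mul_mem_mul (le_localAt p O hO.one_mem) hx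

/-- **`I P` is an invertible right `O`-ideal** (locally principal at every prime: `β u` at `p`,
the local generator of `I` elsewhere; Kaplansky's criterion). [cite: VignerasLNM800, Ch. II §1 Cor. 1.7] -/
theorem isInvertibleRightIdeal_mul_normPrimeIdeal (hO : IsZOrder O) {I : Submodule ℤ B}
    (hI : IsInvertibleRightIdeal O I) : IsInvertibleRightIdeal O (I * normPrimeIdeal O p) := by
  have hdiv : ∀ x : B, x ≠ 0 → IsUnit x := forall_isUnit_of_padic_division hdivp
  have hPfg : (normPrimeIdeal O p).FG := Submodule.FG.of_le hO.isFullLattice.1 (normPrimeIdeal_le O p)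
  have hfull : IsFullLattice B (I * normPrimeIdeal O p) := by
    refine ⟨hI.isFullLattice.1.mul hPfg, fun d => ?_⟩
    obtain ⟨n, hn, hnd⟩ := hI.isFullLattice.2 d
    refine ⟨p * n, mul_ne_zero (by exact_mod_cast hp.out.ne_zero) hn, ?_⟩
    rw [mul_smul]
    exact smul_le_mul_normPrimeIdeal hO I (Submodule.smul_mem_pointwise_smul _ _ I hnd)
  refine IsInvertibleRightIdeal.of_forall_localAt_eq_units_smul hO hfull fun q hq => ?_
  haveI : Fact q.Prime := ⟨hq⟩
  by_cases hqp : q = p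
  · rw [hqp]
    obtain ⟨β, -, hβ⟩ := hI.exists_localAt_eq_units_smul hdiv hO p
    obtain ⟨u, hu, hup⟩ := exists_uniformiser hdivp hO
    exact ⟨β * u, localAt_mul_normPrimeIdeal_self hdivp hOp hO hβ hu hup⟩
  · obtain ⟨β, -, hβ⟩ := hI.exists_localAt_eq_units_smul hdiv hO q
    exact ⟨β, by rw [localAt_mul_normPrimeIdeal_of_ne hO hI hq hqp, hβ]⟩

/-- **`[I : I P] = p²`** (the reduced norm of `P` is `p`). [cite: VignerasLNM800, Ch. II §1 Cor. 1.7] -/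
theorem relIndex_mul_normPrimeIdeal (hO : IsZOrder O) {I : Submodule ℤ B}
    (hI : IsInvertibleRightIdeal O I) :
    (I * normPrimeIdeal O p).toAddSubgroup.relIndex I.toAddSubgroup = p ^ 2 := by
  have hdiv : ∀ x : B, x ≠ 0 → IsUnit x := forall_isUnit_of_padic_division hdivp
  -- `[I : I P] ∣ [I : p I] = p⁴`, so it is `p^j`
  have h4 := relIndex_natCast_smul_eq_pow_four hI.isFullLattice hp.out.ne_zero (p := p)
  have hdvd : (I * normPrimeIdeal O p).toAddSubgroup.relIndex I.toAddSubgroup ∣ p ^ 4 :=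
    h4 ▸ AddSubgroup.relIndex_dvd_of_le_left _
      (Submodule.toAddSubgroup_mono (smul_le_mul_normPrimeIdeal hO I))
  obtain ⟨j, -, hj⟩ := (Nat.dvd_prime_pow hp.out).mp hdvd
  -- its `p`-part is the local index `[I_(p) : (I P)_(p)] = [O_(p) : u O_(p)] = p²`
  have hloc := relIndex_localAt (p := p) I (I * normPrimeIdeal O p) (mul_normPrimeIdeal_le hI)
    (by rw [hj]; exact pow_ne_zero _ hp.out.ne_zero)
  obtain ⟨β, -, hβ⟩ := hI.exists_localAt_eq_units_smul hdiv hO p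
  obtain ⟨u, hu, hup⟩ := exists_uniformiser hdivp hO
  rw [hj, Nat.Prime.factorization_pow hp.out, Finsupp.single_eq_same,
    localAt_mul_normPrimeIdeal_self hdivp hOp hO hβ hu hup, hβ, mul_smul, relIndex_units_smul,
    ← localAt_normPrimeIdeal_eq_units_smul hdivp hOp hO hu hup,
    relIndex_localAt_normPrimeIdeal hdivp hOp hO] at hloc
  rw [hj, Nat.pow_right_injective hp.out.two_le hloc]

/-- **Uniqueness: the only invertible right `O`-ideal `M ⊆ I` of index `p²` is `I P`.** Such an
`M` contains `p I` (`IsInvertibleRightIdeal.natCast_smul_mem_of_relIndex_eq_sq`), so `M_(q) = I_(q)`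
for `q ≠ p`; and `β⁻¹ M_(p) ⊆ O_(p)` is a right `O_(p)`-ideal of index `p²`, hence `P_(p)`
(`eq_localAt_normPrimeIdeal_of_relIndex_eq_sq`). (Vignéras III §5 ex. 5.8 (b): `c(p) = 1` for
`p ∣ D`.) [cite: VignerasLNM800, Ch. III §5 exercice 5.8 (b)] -/
theorem eq_mul_normPrimeIdeal_of_relIndex_eq_sq (hO : IsZOrder O) {I M : Submodule ℤ B}
    (hI : IsInvertibleRightIdeal O I) (hM : IsInvertibleRightIdeal O M) (hle : M ≤ I)
    (hidx : M.toAddSubgroup.relIndex I.toAddSubgroup = p ^ 2) : M = I * normPrimeIdeal O p := by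
  have hdiv : ∀ x : B, x ≠ 0 → IsUnit x := forall_isUnit_of_padic_division hdivp
  have hpI : ∀ y ∈ I, (p : ℤ) • y ∈ M := fun y hy =>
    hM.natCast_smul_mem_of_relIndex_eq_sq hdiv hO hI hle hidx hy
  refine eq_iff_forall_prime_localAt_eq.mpr fun q hq => ?_
  haveI : Fact q.Prime := ⟨hq⟩
  by_cases hqp : q = p
  · rw [hqp]
    obtain ⟨β, -, hβ⟩ := hI.exists_localAt_eq_units_smul hdiv hO p
    obtain ⟨u, hu, hup⟩ := exists_uniformiser hdivp hO
    rw [localAt_mul_normPrimeIdeal_self hdivp hOp hO hβ hu hup, mul_smul,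
      ← localAt_normPrimeIdeal_eq_units_smul hdivp hOp hO hu hup]
    have hβ' : localAt p O = β⁻¹ • localAt p I := by rw [hβ, inv_smul_smul]
    have hN := eq_localAt_normPrimeIdeal_of_relIndex_eq_sq hdivp hOp hO (N := β⁻¹ • localAt p M)
      ?_ ?_ ?_
    · rw [← hN, smul_inv_smul]
    · rw [hβ']
      exact units_smul_mono β⁻¹ (localAt_mono p hle)
    · intro m hm o ho
      rw [mem_units_smul_submodule_iff, inv_inv] at hm ⊢
      rw [Units.smul_def, smul_eq_mul, ← mul_assoc]
      refine mul_mem_localAt_of_mul_mem (fun a ha b hb => hM.mul_mem ha hb) hm ?_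
      exact ho
    · rw [hβ', relIndex_units_smul, relIndex_localAt I M hle (by rw [hidx]; exact pow_ne_zero 2 hp.out.ne_zero),
        hidx, Nat.Prime.factorization_pow hp.out, Finsupp.single_eq_same]
  · rw [localAt_mul_normPrimeIdeal_of_ne hO hI hq hqp]
    exact (localAt_eq_of_smul_le hle hp.out.ne_zero
      ((Nat.coprime_primes hp.out hq).mpr (Ne.symm hqp)) hpI).symm

/-- **`I P P = p I`**: the translate `p I` is an invertible right ideal inside `I P` of index
`[I P : p I] = p⁴ / p² = p²`, so it is `(I P) P` by uniqueness (Vignéras III §5 ex. 5.8 (c):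
`P(p) P(p) = P(p²)`, `P(p²) = L(p)`). [cite: VignerasLNM800, Ch. III §5 exercice 5.8 (c)] -/
theorem mul_normPrimeIdeal_mul_normPrimeIdeal (hO : IsZOrder O) {I : Submodule ℤ B}
    (hI : IsInvertibleRightIdeal O I) :
    I * normPrimeIdeal O p * normPrimeIdeal O p = (p : ℤ) • I := by
  obtain ⟨ν, hν, -⟩ := Brandt.exists_units_val_eq_natCast (D := B) hp.out.ne_zero
  have hpI : (p : ℤ) • I = ν • I := by
    ext x
    constructor
    · intro hx
      obtain ⟨y, hy, rfl⟩ := (Submodule.mem_smul_pointwise_iff_exists x _ I).mp hx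
      exact Brandt.units_smul_eq_zsmul_of_val_eq hν I hy
    · intro hx
      obtain ⟨y, hy, rfl⟩ := Brandt.exists_eq_zsmul_of_mem_units_smul hν hx
      exact Submodule.smul_mem_pointwise_smul y _ I hy
  have hIP := isInvertibleRightIdeal_mul_normPrimeIdeal hdivp hOp hO hI
  refine (eq_mul_normPrimeIdeal_of_relIndex_eq_sq hdivp hOp hO hIP (hpI ▸ hI.units_smul ν)
    (smul_le_mul_normPrimeIdeal hO I) ?_).symm
  -- `[I P : p I] [I : I P] = [I : p I] = p⁴`
  have hmul := AddSubgroup.relIndex_mul_relIndex ((p : ℤ) • I).toAddSubgroup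
    (I * normPrimeIdeal O p).toAddSubgroup I.toAddSubgroup
    (Submodule.toAddSubgroup_mono (smul_le_mul_normPrimeIdeal hO I))
    (Submodule.toAddSubgroup_mono (mul_normPrimeIdeal_le hI))
  rw [relIndex_mul_normPrimeIdeal hdivp hOp hO hI,
    relIndex_natCast_smul_eq_pow_four hI.isFullLattice hp.out.ne_zero,
    show p ^ 4 = p ^ 2 * p ^ 2 by ring] at hmul
  exact Nat.eq_of_mul_eq_mul_right (pow_pos hp.out.pos 2) hmul

end IdealIP

/-! ### The Brandt matrix `B(p)` -/

section Brandt

variable (hdivp : ∀ X : ScalarExtension ℚ ℚ_[p] B, X ≠ 0 → IsUnit X)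
variable (hOp : ∀ x : B, x ∈ localAt p O ↔
  ¬ p ∣ (reducedNorm ℚ B x).den ∧ ¬ p ∣ (reducedTrace ℚ B x).den)
include hdivp hOp

/-- The sub-ideals of index `p²` of an invertible right ideal `I`, as a predicate on
`invertibleRightIdeals O`: exactly `I P`. [cite: VignerasLNM800, Ch. III §5 exercice 5.8 (b)] -/
theorem subideal_iff_eq_mul_normPrimeIdeal (hO : IsZOrder O) {I : Submodule ℤ B}
    (hI : IsInvertibleRightIdeal O I) (M : invertibleRightIdeals O) :
    ((M : Submodule ℤ B) ≤ I ∧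
      (M : Submodule ℤ B).toAddSubgroup.relIndex I.toAddSubgroup = p ^ 2) ↔
        (M : Submodule ℤ B) = I * normPrimeIdeal O p :=
  ⟨fun h => eq_mul_normPrimeIdeal_of_relIndex_eq_sq hdivp hOp hO hI M.2 h.1 h.2, fun h => by
    rw [h]; exact ⟨mul_normPrimeIdeal_le hI, relIndex_mul_normPrimeIdeal hdivp hOp hO hI⟩⟩

/-- **`B(p)_{[I] j} = 1` for `j = [I P]`** (the single sub-ideal `I P`). [cite: VignerasLNM800, Ch. III §5 exercice 5.8 (b)] -/
theorem subidealCount_ramified_eq_one (hO : IsZOrder O) {I : Submodule ℤ B}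
    (hI : IsInvertibleRightIdeal O I) {j : RightIdealClass O}
    (hj : RightIdealClass.mk ⟨I * normPrimeIdeal O p,
      isInvertibleRightIdeal_mul_normPrimeIdeal hdivp hOp hO hI⟩ = j) :
    subidealCount O I p j = 1 := by
  unfold subidealCount
  rw [Nat.card_eq_one_iff_unique]
  refine ⟨⟨fun a b => Subtype.ext (Subtype.ext ?_)⟩, ⟨⟨⟨I * normPrimeIdeal O p,
    isInvertibleRightIdeal_mul_normPrimeIdeal hdivp hOp hO hI⟩, mul_normPrimeIdeal_le hI,
    relIndex_mul_normPrimeIdeal hdivp hOp hO hI, hj⟩⟩⟩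
  rw [(subideal_iff_eq_mul_normPrimeIdeal hdivp hOp hO hI a.1).mp ⟨a.2.1, a.2.2.1⟩,
    (subideal_iff_eq_mul_normPrimeIdeal hdivp hOp hO hI b.1).mp ⟨b.2.1, b.2.2.1⟩]

/-- **`B(p)_{[I] j} = 0` for `j ≠ [I P]`.** [cite: VignerasLNM800, Ch. III §5 exercice 5.8 (b)] -/
theorem subidealCount_ramified_eq_zero (hO : IsZOrder O) {I : Submodule ℤ B}
    (hI : IsInvertibleRightIdeal O I) {j : RightIdealClass O}
    (hj : RightIdealClass.mk ⟨I * normPrimeIdeal O p,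
      isInvertibleRightIdeal_mul_normPrimeIdeal hdivp hOp hO hI⟩ ≠ j) :
    subidealCount O I p j = 0 := by
  unfold subidealCount
  rw [Nat.card_eq_zero]
  refine Or.inl ⟨fun a => hj ?_⟩
  rw [← a.2.2.2]
  congr 1
  exact Subtype.ext ((subideal_iff_eq_mul_normPrimeIdeal hdivp hOp hO hI a.1).mp ⟨a.2.1, a.2.2.1⟩).symm

/-- **Row sums of `B(p)` are `1` at a ramified prime**: `∑ j B(p)_{[I] j} = 1` — every
invertible right ideal has exactly one invertible sub-ideal of index `p²` (Vignéras III §5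
ex. 5.8 (b): `c(p) = 1 si p ∣ D`; in the transposed convention of `Brandt.matrix` these are
column sums). [cite: VignerasLNM800, Ch. III §5 exercice 5.8 (b)] -/
theorem sum_subidealCount_ramified (hO : IsZOrder O) [Fintype (RightIdealClass O)]
    {I : Submodule ℤ B} (hI : IsInvertibleRightIdeal O I) : ∑ j, subidealCount O I p j = 1 := by
  classical
  rw [Finset.sum_eq_single (RightIdealClass.mk ⟨I * normPrimeIdeal O p,
      isInvertibleRightIdeal_mul_normPrimeIdeal hdivp hOp hO hI⟩)]
  · exact subidealCount_ramified_eq_one hdivp hOp hO hI rfl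
  · exact fun j _ hj => subidealCount_ramified_eq_zero hdivp hOp hO hI (Ne.symm hj)
  · exact fun h => absurd (Finset.mem_univ _) h

open Classical in
/-- The entries of the Brandt matrix `B(p)` of `BrandtData.ofOrder O` at a ramified prime:
`B(p)_{i j} = 1` if `j = [I_i P]`, else `0`. [cite: VignerasLNM800, Ch. III §5 exercice 5.8 (b)] -/
theorem BrandtData.ofOrder_T_ramified_apply (hO : IsZOrder O) (i j : RightIdealClass O) :
    (BrandtData.ofOrder O hO).T p i j =
      if RightIdealClass.mk ⟨RightIdealClass.rep i * normPrimeIdeal O p,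
        isInvertibleRightIdeal_mul_normPrimeIdeal hdivp hOp hO
          (RightIdealClass.isInvertibleRightIdeal_rep i)⟩ = j then 1 else 0 := by
  rw [BrandtData.ofOrder_T]
  split_ifs with h
  · rw [subidealCount_ramified_eq_one hdivp hOp hO (RightIdealClass.isInvertibleRightIdeal_rep i) h,
      Nat.cast_one]
  · rw [subidealCount_ramified_eq_zero hdivp hOp hO (RightIdealClass.isInvertibleRightIdeal_rep i) h,
      Nat.cast_zero]

/-- **Row sums of the Brandt matrix `B(p)` are `1`** at a ramified prime. [cite: VignerasLNM800, Ch. III §5 exercice 5.8 (b)] -/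
theorem BrandtData.ofOrder_T_ramified_sum (hO : IsZOrder O) (i : RightIdealClass O) :
    ∑ j, (BrandtData.ofOrder O hO).T p i j = 1 := by
  letI : Fintype (RightIdealClass O) := (BrandtData.ofOrder O hO).instFintype
  have h := sum_subidealCount_ramified hdivp hOp hO (RightIdealClass.isInvertibleRightIdeal_rep i)
  have : ∑ j, (BrandtData.ofOrder O hO).T p i j = ((∑ j, subidealCount O (RightIdealClass.rep i) p j : ℕ) : ℤ) := by
    push_cast
    exact Finset.sum_congr rfl fun j _ => rfl
  rw [this, h, Nat.cast_one]

/-- The class of `I_j P` is `i` when `j = [I_i P]`: `[I P P] = [p I] = [I]`. [cite: VignerasLNM800, Ch. III §5 exercice 5.8 (c)] -/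
theorem RightIdealClass.mk_rep_mul_normPrimeIdeal_of_eq (hO : IsZOrder O) {i j : RightIdealClass O}
    (h : RightIdealClass.mk ⟨RightIdealClass.rep i * normPrimeIdeal O p,
      isInvertibleRightIdeal_mul_normPrimeIdeal hdivp hOp hO
        (RightIdealClass.isInvertibleRightIdeal_rep i)⟩ = j) :
    RightIdealClass.mk ⟨RightIdealClass.rep j * normPrimeIdeal O p,
      isInvertibleRightIdeal_mul_normPrimeIdeal hdivp hOp hO
        (RightIdealClass.isInvertibleRightIdeal_rep j)⟩ = i := by
  -- `rep j = b • (rep i * P)` for a unit `b`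
  have hj := (RightIdealClass.mk_rep j).trans h.symm
  obtain ⟨b, hb⟩ := RightIdealClass.mk_eq_mk_iff.mp hj.symm
  -- so `rep j * P = b • (rep i * P * P) = b • (ν • rep i)`, of class `i`
  obtain ⟨ν, hν, -⟩ := Brandt.exists_units_val_eq_natCast (D := B) hp.out.ne_zero
  have hIPP := mul_normPrimeIdeal_mul_normPrimeIdeal hdivp hOp hO
    (RightIdealClass.isInvertibleRightIdeal_rep i)
  have hpI : (p : ℤ) • RightIdealClass.rep i = ν • RightIdealClass.rep i := by
    ext x
    constructor
    · intro hx
      obtain ⟨y, hy, rfl⟩ := (Submodule.mem_smul_pointwise_iff_exists x _ _).mp hx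
      exact Brandt.units_smul_eq_zsmul_of_val_eq hν _ hy
    · intro hx
      obtain ⟨y, hy, rfl⟩ := Brandt.exists_eq_zsmul_of_mem_units_smul hν hx
      exact Submodule.smul_mem_pointwise_smul y _ _ hy
  have hkey : RightIdealClass.rep j * normPrimeIdeal O p = (b * ν) • RightIdealClass.rep i := by
    change ((⟨RightIdealClass.rep j, _⟩ : invertibleRightIdeals O) : Submodule ℤ B) * _ = _
    rw [hb]
    change (b • (RightIdealClass.rep i * normPrimeIdeal O p)) * normPrimeIdeal O p = _
    rw [smul_mul_assoc, hIPP, hpI, mul_smul]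
  rw [← RightIdealClass.mk_rep i]
  conv_rhs => rw [← RightIdealClass.mk_units_smul (b * ν)
    ⟨RightIdealClass.rep i, RightIdealClass.isInvertibleRightIdeal_rep i⟩]
  congr 1
  exact Subtype.ext hkey

/-- **`B(p) B(p) = 1` at a ramified prime: the Brandt matrix `B(p)`, `p ∣ disc B`, is an
involutive permutation matrix** (the Atkin–Lehner involution `W_p` on the Brandt module;
Vignéras III §5 ex. 5.8 (c): `P(p) P(p) = P(p²)`, and `P(p²) = L(p)` is the identity over `ℚ`). [cite: VignerasLNM800, Ch. III §5 exercice 5.8 (c)] -/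
theorem BrandtData.ofOrder_T_ramified_mul_self (hO : IsZOrder O) :
    (BrandtData.ofOrder O hO).T p * (BrandtData.ofOrder O hO).T p = 1 := by
  letI : Fintype (RightIdealClass O) := (BrandtData.ofOrder O hO).instFintype
  ext i k
  rw [Matrix.mul_apply, Matrix.one_apply]
  set j₀ : RightIdealClass O := RightIdealClass.mk ⟨RightIdealClass.rep i * normPrimeIdeal O p,
    isInvertibleRightIdeal_mul_normPrimeIdeal hdivp hOp hO
      (RightIdealClass.isInvertibleRightIdeal_rep i)⟩ with hj₀
  have hsum : ∑ j, (BrandtData.ofOrder O hO).T p i j * (BrandtData.ofOrder O hO).T p j k =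
      (BrandtData.ofOrder O hO).T p i j₀ * (BrandtData.ofOrder O hO).T p j₀ k := by
    refine Fintype.sum_eq_single j₀ fun j hj => ?_
    rw [BrandtData.ofOrder_T_ramified_apply hdivp hOp hO i j, if_neg (fun h => hj (h ▸ hj₀).symm),
      zero_mul]
  rw [hsum, BrandtData.ofOrder_T_ramified_apply hdivp hOp hO i j₀, if_pos hj₀.symm, one_mul,
    BrandtData.ofOrder_T_ramified_apply hdivp hOp hO j₀ k,
    RightIdealClass.mk_rep_mul_normPrimeIdeal_of_eq hdivp hOp hO hj₀.symm]
  split_ifs <;> first | rfl | contradiction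

end Brandt


/-! ### Eichler packages: `B(p)² = 1` for `p ∣ N⁻` -/

section Package

open NumberField IsDedekindDomain

variable {Nplus Nminus : ℕ}

/-- For an Eichler package of level `(N⁺, N⁻)` and a prime `p ∣ N⁻`, the base change
`ℚ_p ⊗ B` is a division algebra (`p` is ramified in `B`). [cite: VignerasLNM800, Ch. II §1 Thm. 1.1 and Ch. III §3] -/
theorem EichlerPackage.forall_isUnit_scalarExtension_padic (P : EichlerPackage Nplus Nminus)
    {p : ℕ} [hp : Fact p.Prime] (hpN : p ∣ Nminus) :
    ∀ X : ScalarExtension ℚ ℚ_[p] P.B, X ≠ 0 → IsUnit X := by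
  set v : HeightOneSpectrum (𝓞 ℚ) := (Rat.HeightOneSpectrum.primesEquiv (R := 𝓞 ℚ)).symm ⟨p, hp.out⟩
    with hv
  have hpv : ((Rat.HeightOneSpectrum.primesEquiv v : Nat.Primes) : ℕ) = p := by
    rw [hv, Equiv.apply_symm_apply]
  have hram : v ∈ ramifiedPlaces ℚ P.B := by
    rw [P.mem_ramifiedPlaces_iff, ← primesEquiv_dvd_iff, hpv]
    exact hpN
  exact forall_isUnit_scalarExtension_padic_of_not_isSplitAt P.B v hram p hpv

/-- The Eichler order of a package is maximal at every prime `p ∣ N⁻`: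
`O_(p) = {x : nrd x, trd x ∈ ℤ_(p)}` (it is an intersection of two maximal orders, which agree
at the ramified prime `p`). [cite: VignerasLNM800, Ch. III §5 (ordres d'Eichler, propriétés locales)] -/
theorem EichlerPackage.maximalAtP (P : EichlerPackage Nplus Nminus) {p : ℕ} [hp : Fact p.Prime]
    (hpN : p ∣ Nminus) :
    ∀ x : P.B, x ∈ localAt p P.O ↔
      ¬ p ∣ (reducedNorm ℚ P.B x).den ∧ ¬ p ∣ (reducedTrace ℚ P.B x).den := by
  obtain ⟨O₁, O₂, hO₁, hO₂, hO, -⟩ := P.isEichlerOrder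
  rw [hO]
  exact maximalAtP_inf hO₁ hO₂ (P.forall_isUnit_scalarExtension_padic hpN)

/-- **`B(p) B(p) = 1` for the Brandt matrices of an Eichler package at a prime `p ∣ N⁻`**: at the
primes dividing the discriminant the Brandt matrix is an involutive permutation matrix (the
Atkin–Lehner involution `W_p`; Vignéras III §5 ex. 5.8 (b)–(c)). [cite: VignerasLNM800, Ch. III §5 exercice 5.8 (b)–(c)] -/
theorem EichlerPackage.T_mul_T_self_of_dvd (P : EichlerPackage Nplus Nminus) {p : ℕ}
    (hp : p.Prime) (hpN : p ∣ Nminus) : P.brandtData.T p * P.brandtData.T p = 1 := by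
  haveI : Fact p.Prime := ⟨hp⟩
  exact BrandtData.ofOrder_T_ramified_mul_self (P.forall_isUnit_scalarExtension_padic hpN)
    (P.maximalAtP hpN) P.isEichlerOrder.isZOrder

/-- **Row sums of `B(p)` are `1` for an Eichler package at `p ∣ N⁻`.** [cite: VignerasLNM800, Ch. III §5 exercice 5.8 (b)] -/
theorem EichlerPackage.T_sum_of_dvd (P : EichlerPackage Nplus Nminus) {p : ℕ} (hp : p.Prime)
    (hpN : p ∣ Nminus) (i : P.brandtData.ι) : ∑ j, P.brandtData.T p i j = 1 := by
  haveI : Fact p.Prime := ⟨hp⟩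
  exact BrandtData.ofOrder_T_ramified_sum (P.forall_isUnit_scalarExtension_padic hpN)
    (P.maximalAtP hpN) P.isEichlerOrder.isZOrder i

end Package


/-! ### Brandt setups (`BrandtXi.lean` vocabulary): `T(p) T(p) = 1` for `p ∣ N⁻` -/

section XiSetup

variable {Nplus Nminus : ℕ}

/-- **For a Brandt setup of type `(N⁺, N⁻)` and a prime `p ∣ N⁻`, the Brandt matrix
`Brandt.matrix S.O p` of `BrandtXi.lean` (the one entering Pollack–Weston's `ξ`) is an
involution**: `T(p) T(p) = 1` (transport of `EichlerPackage.T_mul_T_self_of_dvd` along the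
dictionary `BrandtData.ofOrder_T_eq_transpose_reindex`). [cite: VignerasLNM800, Ch. III §5 exercice 5.8 (b)–(c)] -/
theorem Brandt.XiSetup.matrix_mul_self_of_dvd (S : Brandt.XiSetup Nplus Nminus)
    [Fintype (Brandt.ClassSet S.O)] [DecidableEq (Brandt.ClassSet S.O)] {p : ℕ} (hp : p.Prime)
    (hpN : p ∣ Nminus) : Brandt.matrix S.O p * Brandt.matrix S.O p = 1 := by
  have hO : IsZOrder S.O := S.toEichlerPackage.isEichlerOrder.isZOrder
  letI : Fintype (RightIdealClass S.O) := S.toEichlerPackage.brandtData.instFintypeι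
  letI : DecidableEq (RightIdealClass S.O) := S.toEichlerPackage.brandtData.instDecidableEqι
  have h : Brandt.rightIdeals S.O = invertibleRightIdeals S.O :=
    rightIdeals_eq_invertibleRightIdeals_of_isTotallyDefinite S.isTotallyDefinite hO
  set e := Brandt.ClassSet.equivRightIdealClass h with he
  -- the dictionary: `matrix p i j = T p (e j) (e i)`
  have hT : ∀ i j, Brandt.matrix S.O p i j = S.toEichlerPackage.brandtData.T p (e j) (e i) :=
    fun i j => (BrandtData.ofOrder_T_equivRightIdealClass hO h p j i).symm
  have h2 := S.toEichlerPackage.T_mul_T_self_of_dvd hp hpN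
  ext a c
  rw [Matrix.mul_apply, Matrix.one_apply]
  simp_rw [hT]
  have hcomm : ∑ b, S.toEichlerPackage.brandtData.T p (e b) (e a) *
      S.toEichlerPackage.brandtData.T p (e c) (e b) =
        ∑ b, S.toEichlerPackage.brandtData.T p (e c) (e b) *
          S.toEichlerPackage.brandtData.T p (e b) (e a) :=
    Finset.sum_congr rfl fun b _ => mul_comm _ _
  rw [hcomm, Equiv.sum_comp e (fun j => S.toEichlerPackage.brandtData.T p (e c) j *
    S.toEichlerPackage.brandtData.T p j (e a))]
  by_cases hac : a = c
  · subst hac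
    have h2' : (S.toEichlerPackage.brandtData.T p * S.toEichlerPackage.brandtData.T p) (e a) (e a) = 1 := by
      rw [h2]; exact Matrix.one_apply_eq _
    rw [Matrix.mul_apply] at h2'
    rw [if_pos rfl]
    exact h2'
  · have hne : e c ≠ e a := fun h' => hac (e.injective h').symm
    have h2' : (S.toEichlerPackage.brandtData.T p * S.toEichlerPackage.brandtData.T p) (e c) (e a) = 0 := by
      rw [h2]; exact Matrix.one_apply_ne hne
    rw [Matrix.mul_apply] at h2'
    rw [if_neg hac]
    exact h2'

end XiSetup

end Literature.NumberTheory.Automorphic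

end
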